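import Literature.MathematicalPhysics.QuantumFieldTheory.QCDOS
import HarnessLib

/-!
# Flavour `U(1)` rephasing of the lattice-QCD Grassmann algebras and the flavour charge of
gauge-invariant local observables

Definition request `defn-fermiFlavourPhase` (route `WilsonMobilityGap` of `QuantumFields/QCD`:
the notion is inlined verbatim in its items `PhaseQuenchedFlavourDecay` and `GluonicCompletion`).

## Content

* **Diagonal rescaling of Grassmann generators** (generic bookkeeping): for weights
  `c : κ → R`, `grassmannRescaleLin R c` is the diagonal linear map `e_w ↦ c_w e_w` of generator
  coefficients and `grassmannRescale R c := ExteriorAlgebra.map (grassmannRescaleLin R c)` the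
  induced algebra endomorphism `θ_w ↦ c_w θ_w` of `GrassmannAlgebra R κ`.  It is a monoid action
  in `c` (`grassmannRescale_one/_mul`), every monomial `θ_s` is an eigenvector with eigenvalue
  `∏_{w ∈ s} c_w` (`grassmannRescale_grassmannBasis`), the Berezin integral is multiplied by
  `∏_w c_w` (`berezin_grassmannRescale`: Berezin's change of variables for the diagonal
  substitution: the integral is the top coefficient, Montvay–Münster (4.21)), it intertwines
  with relabellings `θ_w ↦ θ_{g w}` of matching weights
  (`map_relabel_comp_grassmannRescale`), and fixed points stay fixed under `grassmannExp`.
* **Flavour phases.** For complex fermions indexed by `ι ⊕ₗ ι` (`ψ̄` before `ψ`) with a flavour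
  labelling `fl : ι → Fin N_f`, the vector `U(1)` rotation of flavour `f₀` by the angle `θ`,
  `ψ_{f₀} ↦ e^{iθ} ψ_{f₀}`, `ψ̄_{f₀} ↦ e^{-iθ} ψ̄_{f₀}`, all other generators fixed, is the rescaling
  by `flavourPhaseWeight fl f₀ θ`; `flavourChargeOf fl f₀ w ∈ {-1, 0, 1}` is the charge of a
  generator.  This is (5.6) of Montvay–Münster with `U = diag(1,…,e^{-iθ},…,1) ∈ U(N_f)` (entry
  at `f₀`), an exact symmetry of the Wilson action for every diagonal mass matrix.
* **The requested notions.** `fermiFlavourPhaseLin f₀ θ` — LITERALLY the linear map inlined in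
  the route, on the boxed quark variables `BoxFermiIdx N_f R ⊕ₗ BoxFermiIdx N_f R` —,
  `fermiFlavourPhase f₀ θ := ExteriorAlgebra.map (fermiFlavourPhaseLin f₀ θ) : BoxFermiAlg N_f R
  →ₐ[ℂ] BoxFermiAlg N_f R` (the pattern of the tree's `fermiGaugeAct`), its torus twin
  `torusFlavourPhase f₀ θ : FermiAlg N_f S →ₐ[ℂ] FermiAlg N_f S`, and the predicate
  `QCDLatticeObservable.IsFlavourCharged A f₀ q :⇔ ∀ θ U, fermiFlavourPhase f₀ θ (A.F U) =
  e^{iqθ} • A.F U`; `isFlavourCharged_iff` unfolds it to the route's inlined hypothesis by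
  `Iff.rfl`, and `fermiFlavourPhase_eq` identifies the literal map with the generic rescaling
  by `rfl`, through which all structure flows.
* **API.** Group action in `θ` (`fermiFlavourPhase_zero/_add/_comp_neg`), action on generators
  (`fermiFlavourPhase_psi/_psiBar`, `torusFlavourPhase_q/_qbar`), charges add under products
  (`map_mul_eq_exp_smul`), monomials are eigenvectors with charge `#ψ_{f₀} − #ψ̄_{f₀}`
  (`fermiFlavourPhase_grassmannBasis`), the torus placement `onTorus` intertwines the box and
  torus rotations (`torusFlavourPhase_map_toTorusIdx`, `IsFlavourCharged.onTorus`), and the KEY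
  LEMMA: the fermionic Boltzmann factor of the flavour-diagonal `diracMatrix` is invariant
  (`torusFlavourPhase_fermiBoltzmann`), the Berezin integral is invariant
  (`fermiIntegral_torusFlavourPhase`), hence the Berezin integral of a charge-`q ≠ 0` element
  against `fermiBoltzmann` vanishes (`fermiIntegral_mul_fermiBoltzmann_eq_zero_of_charged`):
  `⟨A⟩_F ≡ 0` configuration-wise for flavour-charged `A`, so its `qcdTorusExpect` vanishes and
  the connected and full Euclidean-time correlators coincide
  (`IsFlavourCharged.qcdTorusExpect_onTorus`, `IsFlavourCharged.qcdLatticeConnectedCorr_eq`).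

## Sources

I. Montvay, G. Münster, *Quantum Fields on a Lattice* (CUP 1994), §5.1.1: the Wilson action of
`N_f` quark flavours and its global flavour symmetry (5.6), `ψ' = U⁻¹ψ`, `ψ̄' = ψ̄U`, `U ∈ U(N_f)`
(exact for equal masses; for a general diagonal mass matrix the diagonal subgroup `U(1)^{N_f}`,
i.e. the rotations formalised here, remains exact because the action is flavour-diagonal), and
§4.1 (Grassmann variables; the integral is the top coefficient, (4.15)/(4.21)); K. Osterwalder,
E. Seiler, Ann. Phys. 110 (1978) 440, §2 (gauge-invariant local observables of lattice gauge
theories with fermions); F. A. Berezin, *The Method of Second Quantization* (1966), Ch. I §3.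

## Design

The box-level map is kept in the literal form inlined by the route, so that restating its items
with `IsFlavourCharged` is a definitional unfolding.  Not here: non-abelian flavour rotations,
axial rotations, Ward identities.
-/

noncomputable section

open Literature.MathematicalPhysics.QuantumLattice Literature.Probability.LatticeModels

namespace Literature.MathematicalPhysics.QuantumFieldTheory

/-! ### Diagonal rescaling of Grassmann generators -/

section Rescale

variable (R : Type*) [CommRing R] {κ : Type*}

/-- The diagonal linear map `e_w ↦ c_w e_w` on generator coefficients `κ → R`,
`(c x)_w = c_w x_w`. [folklore] -/
def grassmannRescaleLin (c : κ → R) : (κ → R) →ₗ[R] (κ → R) :=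
  LinearMap.pi fun w => c w • LinearMap.proj w

/-- Coordinates of the rescaled coefficient vector. [folklore] -/
@[simp] theorem grassmannRescaleLin_apply (c : κ → R) (x : κ → R) (w : κ) :
    grassmannRescaleLin R c x w = c w * x w := rfl

/-- The rescaling multiplies the basis vector `e_i` by `c_i`. [folklore] -/
theorem grassmannRescaleLin_single [DecidableEq κ] (c : κ → R) (i : κ) (r : R) :
    grassmannRescaleLin R c (Pi.single i r) = c i • Pi.single i r := by
  ext w
  by_cases h : w = i
  · subst h; simp
  · simp [Pi.single_eq_of_ne h]

/-- The algebra endomorphism `θ_w ↦ c_w θ_w` of the Grassmann algebra induced by a diagonal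
rescaling of the generators (functoriality of the exterior algebra). [folklore] -/
def grassmannRescale (c : κ → R) : GrassmannAlgebra R κ →ₐ[R] GrassmannAlgebra R κ :=
  ExteriorAlgebra.map (grassmannRescaleLin R c)

/-- Action on degree-one elements. [folklore] -/
theorem grassmannRescale_ι (c : κ → R) (x : κ → R) :
    grassmannRescale R c (ExteriorAlgebra.ι R x) =
      ExteriorAlgebra.ι R (grassmannRescaleLin R c x) :=
  ExteriorAlgebra.map_apply_ι _ _

/-- Action on generators: `θ_i ↦ c_i θ_i`. [folklore] -/
@[simp] theorem grassmannRescale_gen [DecidableEq κ] (c : κ → R) (i : κ) :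
    grassmannRescale R c (GrassmannAlgebra.gen R i) = c i • GrassmannAlgebra.gen R i := by
  rw [GrassmannAlgebra.gen, grassmannRescale_ι, grassmannRescaleLin_single, map_smul]

/-- Unit weights act as the identity. [folklore] -/
theorem grassmannRescale_one : grassmannRescale R (fun _ : κ => (1 : R)) = AlgHom.id R _ := by
  have h : grassmannRescaleLin R (fun _ : κ => (1 : R)) = LinearMap.id :=
    LinearMap.ext fun x => funext fun w => by simp
  rw [grassmannRescale, h, ExteriorAlgebra.map_id]

/-- Rescaling is multiplicative in the weights (a monoid action of `κ → R`). [folklore] -/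
theorem grassmannRescale_mul (c d : κ → R) :
    grassmannRescale R (c * d) = (grassmannRescale R c).comp (grassmannRescale R d) := by
  have h : grassmannRescaleLin R (c * d) =
      (grassmannRescaleLin R c).comp (grassmannRescaleLin R d) :=
    LinearMap.ext fun x => funext fun w => by simp [mul_assoc]
  rw [grassmannRescale, grassmannRescale, grassmannRescale, ExteriorAlgebra.map_comp_map, h]

/-- A fixed point of an algebra endomorphism stays fixed under the Grassmann exponential
(`exp` is a finite `ℚ`-linear combination of powers). [folklore] -/
theorem map_grassmannExp_of_map_eq {A : Type*} [CommRing A] [Algebra ℚ A] {ι' : Type*}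
    (φ : GrassmannAlgebra A ι' →ₐ[A] GrassmannAlgebra A ι') {a : GrassmannAlgebra A ι'}
    (h : φ a = a) : φ (grassmannExp a) = grassmannExp a := by
  unfold grassmannExp IsNilpotent.exp
  rw [map_sum]
  exact Finset.sum_congr rfl fun i _ => by rw [map_rat_smul, map_pow, h]

/-- Rescaling intertwines with a relabelling `θ_w ↦ θ_{g w}` of generators whose weights match,
`c'_{g w} = c_w`. [folklore] -/
theorem map_relabel_comp_grassmannRescale [Fintype κ] {κ' : Type*} [DecidableEq κ'] (g : κ → κ')
    (c : κ → R) (c' : κ' → R) (h : ∀ w, c' (g w) = c w) :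
    (ExteriorAlgebra.map (Fintype.linearCombination R fun w => Pi.single (g w) (1 : R))).comp
        (grassmannRescale R c) =
      (grassmannRescale R c').comp
        (ExteriorAlgebra.map (Fintype.linearCombination R fun w => Pi.single (g w) (1 : R))) := by
  rw [grassmannRescale, grassmannRescale, ExteriorAlgebra.map_comp_map,
    ExteriorAlgebra.map_comp_map]
  congr 1
  refine LinearMap.ext fun x => ?_
  simp only [LinearMap.comp_apply, Fintype.linearCombination_apply, map_sum, map_smul,
    grassmannRescaleLin_single, grassmannRescaleLin_apply, h, smul_smul]
  exact Finset.sum_congr rfl fun w _ => by rw [mul_comm]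

variable [LinearOrder κ] [Fintype κ]

/-- Every monomial is an eigenvector: `θ_s ↦ (∏_{w ∈ s} c_w) θ_s`. [folklore] -/
theorem grassmannRescale_grassmannBasis (c : κ → R) (s : Finset κ) :
    grassmannRescale R c (GrassmannAlgebra.grassmannBasis R κ s) =
      (∏ i ∈ s, c i) • GrassmannAlgebra.grassmannBasis R κ s := by
  have hb : GrassmannAlgebra.grassmannBasis R κ s =
      ExteriorAlgebra.ιMulti R s.card (⇑(Pi.basisFun R κ) ∘ ⇑(s.orderEmbOfFin rfl)) := by
    rw [GrassmannAlgebra.grassmannBasis,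
      ExteriorAlgebra.basis_apply_ofCard (Pi.basisFun R κ) (rfl : s.card = s.card)]
    rfl
  have hcomp : ⇑(grassmannRescaleLin R c) ∘ (⇑(Pi.basisFun R κ) ∘ ⇑(s.orderEmbOfFin rfl)) =
      fun k => c (s.orderEmbOfFin rfl k) • (⇑(Pi.basisFun R κ) ∘ ⇑(s.orderEmbOfFin rfl)) k := by
    funext k
    simp only [Function.comp_apply, Pi.basisFun_apply, grassmannRescaleLin_single]
  have hprod : ∏ k : Fin s.card, c (s.orderEmbOfFin rfl k) = ∏ i ∈ s, c i := by
    have h := Finset.prod_map Finset.univ (s.orderEmbOfFin rfl).toEmbedding c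
    rw [Finset.map_orderEmbOfFin_univ] at h
    rw [h]
    rfl
  rw [hb, grassmannRescale, ExteriorAlgebra.map_apply_ιMulti, hcomp, AlternatingMap.map_smul_univ,
    hprod]

/-- **Change of variables in the Berezin integral** for the diagonal substitution
`θ_w ↦ c_w θ_w`: `∫dθ (c·x) = (∏_w c_w) ∫dθ x` — the integral is the coefficient of the top
monomial (Montvay–Münster (4.21)), which the substitution multiplies by `∏_w c_w`. [cite: MontvayMunster1994, §4.1 (4.21)] -/
theorem berezin_grassmannRescale (c : κ → R) (x : GrassmannAlgebra R κ) :
    GrassmannAlgebra.berezin R κ (grassmannRescale R c x) =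
      (∏ i, c i) * GrassmannAlgebra.berezin R κ x := by
  suffices h : (GrassmannAlgebra.berezin R κ).comp (grassmannRescale R c).toLinearMap =
      (∏ i, c i) • GrassmannAlgebra.berezin R κ from LinearMap.congr_fun h x
  refine (GrassmannAlgebra.grassmannBasis R κ).ext fun s => ?_
  simp only [LinearMap.comp_apply, AlgHom.toLinearMap_apply, LinearMap.smul_apply,
    grassmannRescale_grassmannBasis, map_smul, smul_eq_mul]
  by_cases hs : s = Finset.univ
  · subst hs; simp
  · simp [GrassmannAlgebra.berezin_grassmannBasis_of_ne R hs]

end Rescale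

/-! ### Flavour phases on complex-fermion generators `ι ⊕ₗ ι` -/

section Flavour

variable {ι : Type*} {Nf : ℕ}

/-- The weights of the vector `U(1)` rotation of flavour `f₀` by the angle `θ` on complex-fermion
generators indexed by `ι ⊕ₗ ι` (`ψ̄` = `inl` before `ψ` = `inr`) with flavour labelling `fl`:
`e^{-iθ}` on `ψ̄` of flavour `f₀`, `e^{+iθ}` on `ψ` of flavour `f₀`, `1` otherwise
(`ψ_f ↦ e^{iθ} ψ_f`, `ψ̄_f ↦ ψ̄_f e^{-iθ}`). [cite: MontvayMunster1994, §5.1.1 (5.6)] -/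
def flavourPhaseWeight (fl : ι → Fin Nf) (f₀ : Fin Nf) (θ : ℝ) : ι ⊕ₗ ι → ℂ := fun w =>
  Sum.elim (fun i => if fl i = f₀ then Complex.exp (-((θ : ℂ) * Complex.I)) else 1)
    (fun i => if fl i = f₀ then Complex.exp ((θ : ℂ) * Complex.I) else 1) (ofLex w)

/-- The integer `U(1)_{f₀}` charge of a generator: `-1` for `ψ̄` of flavour `f₀`, `+1` for `ψ` of
flavour `f₀`, `0` otherwise. [cite: MontvayMunster1994, §5.1.1 (5.6)] -/
def flavourChargeOf (fl : ι → Fin Nf) (f₀ : Fin Nf) : ι ⊕ₗ ι → ℤ := fun w =>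
  Sum.elim (fun i => if fl i = f₀ then -1 else 0) (fun i => if fl i = f₀ then 1 else 0) (ofLex w)

/-- Weight of `ψ̄ᵢ`. [folklore] -/
@[simp] theorem flavourPhaseWeight_inl (fl : ι → Fin Nf) (f₀ : Fin Nf) (θ : ℝ) (i : ι) :
    flavourPhaseWeight fl f₀ θ (toLex (Sum.inl i)) =
      if fl i = f₀ then Complex.exp (-((θ : ℂ) * Complex.I)) else 1 := rfl

/-- Weight of `ψᵢ`. [folklore] -/
@[simp] theorem flavourPhaseWeight_inr (fl : ι → Fin Nf) (f₀ : Fin Nf) (θ : ℝ) (i : ι) :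
    flavourPhaseWeight fl f₀ θ (toLex (Sum.inr i)) =
      if fl i = f₀ then Complex.exp ((θ : ℂ) * Complex.I) else 1 := rfl

/-- Charge of `ψ̄ᵢ`. [folklore] -/
@[simp] theorem flavourChargeOf_inl (fl : ι → Fin Nf) (f₀ : Fin Nf) (i : ι) :
    flavourChargeOf fl f₀ (toLex (Sum.inl i)) = if fl i = f₀ then -1 else 0 := rfl

/-- Charge of `ψᵢ`. [folklore] -/
@[simp] theorem flavourChargeOf_inr (fl : ι → Fin Nf) (f₀ : Fin Nf) (i : ι) :
    flavourChargeOf fl f₀ (toLex (Sum.inr i)) = if fl i = f₀ then 1 else 0 := rfl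

/-- The weight of a generator is `e^{i q θ}`, `q` its charge. [folklore] -/
theorem flavourPhaseWeight_eq_exp (fl : ι → Fin Nf) (f₀ : Fin Nf) (θ : ℝ) (w : ι ⊕ₗ ι) :
    flavourPhaseWeight fl f₀ θ w =
      Complex.exp ((((flavourChargeOf fl f₀ w : ℝ) * θ : ℝ) : ℂ) * Complex.I) := by
  obtain ⟨w, rfl⟩ := toLex.surjective w
  rcases w with i | i <;> by_cases h : fl i = f₀ <;> simp [h]

/-- Angle `0` gives unit weights. [folklore] -/
theorem flavourPhaseWeight_zero (fl : ι → Fin Nf) (f₀ : Fin Nf) :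
    flavourPhaseWeight fl f₀ 0 = fun _ => 1 := by
  funext w
  obtain ⟨w, rfl⟩ := toLex.surjective w
  rcases w with i | i <;> simp

/-- The weights are multiplicative in the angle. [folklore] -/
theorem flavourPhaseWeight_add (fl : ι → Fin Nf) (f₀ : Fin Nf) (θ₁ θ₂ : ℝ) :
    flavourPhaseWeight fl f₀ (θ₁ + θ₂) = flavourPhaseWeight fl f₀ θ₁ * flavourPhaseWeight fl f₀ θ₂ := by
  funext w
  rw [Pi.mul_apply, flavourPhaseWeight_eq_exp, flavourPhaseWeight_eq_exp, flavourPhaseWeight_eq_exp,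
    ← Complex.exp_add]
  congr 1
  push_cast
  ring

/-- The weights of `ψ̄ᵢ` and `ψⱼ` cancel when `i`, `j` carry the same flavour. [folklore] -/
theorem flavourPhaseWeight_inl_mul_inr (fl : ι → Fin Nf) (f₀ : Fin Nf) (θ : ℝ) {i j : ι}
    (hij : fl i = fl j) :
    flavourPhaseWeight fl f₀ θ (toLex (Sum.inl i)) * flavourPhaseWeight fl f₀ θ (toLex (Sum.inr j)) = 1 := by
  rw [flavourPhaseWeight_inl, flavourPhaseWeight_inr, hij]
  by_cases h : fl j = f₀
  · rw [if_pos h, if_pos h, ← Complex.exp_add, neg_add_cancel, Complex.exp_zero]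
  · rw [if_neg h, if_neg h, one_mul]

/-- The product of ALL weights is `1` (as many `ψ̄` as `ψ` of each flavour). [folklore] -/
theorem prod_flavourPhaseWeight [Fintype ι] (fl : ι → Fin Nf) (f₀ : Fin Nf) (θ : ℝ) :
    ∏ w, flavourPhaseWeight fl f₀ θ w = 1 := by
  rw [← Fintype.prod_equiv toLex (fun x => flavourPhaseWeight fl f₀ θ (toLex x)) _ (fun _ => rfl),
    Fintype.prod_sum_type, ← Finset.prod_mul_distrib]
  exact Finset.prod_eq_one fun i _ => flavourPhaseWeight_inl_mul_inr fl f₀ θ rfl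

/-- Total charge of a set of generators is the integer `#ψ_{f₀} − #ψ̄_{f₀}`; its exponential is
the product of the weights. [folklore] -/
theorem prod_flavourPhaseWeight_eq_exp (fl : ι → Fin Nf) (f₀ : Fin Nf) (θ : ℝ)
    (s : Finset (ι ⊕ₗ ι)) :
    ∏ w ∈ s, flavourPhaseWeight fl f₀ θ w =
      Complex.exp (((((∑ w ∈ s, flavourChargeOf fl f₀ w : ℤ) : ℝ) * θ : ℝ) : ℂ) * Complex.I) := by
  rw [Finset.prod_congr rfl fun w _ => flavourPhaseWeight_eq_exp fl f₀ θ w, ← Complex.exp_sum]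
  congr 1
  push_cast
  simp only [Finset.sum_mul]

variable [DecidableEq ι]

/-- `ψᵢ ↦ e^{iθ} ψᵢ` for flavour `f₀`, fixed otherwise. [cite: MontvayMunster1994, §5.1.1 (5.6)] -/
theorem grassmannRescale_flavour_psi (fl : ι → Fin Nf) (f₀ : Fin Nf) (θ : ℝ) (i : ι) :
    grassmannRescale ℂ (flavourPhaseWeight fl f₀ θ) (psi ℂ i) =
      (if fl i = f₀ then Complex.exp ((θ : ℂ) * Complex.I) else 1) • psi ℂ i := by
  rw [psi, grassmannRescale_gen, flavourPhaseWeight_inr]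

/-- `ψ̄ᵢ ↦ e^{-iθ} ψ̄ᵢ` for flavour `f₀`, fixed otherwise. [cite: MontvayMunster1994, §5.1.1 (5.6)] -/
theorem grassmannRescale_flavour_psiBar (fl : ι → Fin Nf) (f₀ : Fin Nf) (θ : ℝ) (i : ι) :
    grassmannRescale ℂ (flavourPhaseWeight fl f₀ θ) (psiBar ℂ i) =
      (if fl i = f₀ then Complex.exp (-((θ : ℂ) * Complex.I)) else 1) • psiBar ℂ i := by
  rw [psiBar, grassmannRescale_gen, flavourPhaseWeight_inl]

variable [Fintype ι]

/-- **Flavour symmetry of a flavour-diagonal bilinear**: `ψ̄ A ψ` is invariant under every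
`U(1)_{f₀}` when `A_{ij} = 0` for `i`, `j` of different flavours. [cite: MontvayMunster1994, §5.1.1 (5.6)] -/
theorem grassmannRescale_flavour_quadratic (fl : ι → Fin Nf) (f₀ : Fin Nf) (θ : ℝ)
    (A : Matrix ι ι ℂ) (hA : ∀ i j, fl i ≠ fl j → A i j = 0) :
    grassmannRescale ℂ (flavourPhaseWeight fl f₀ θ) (quadratic ℂ A) = quadratic ℂ A := by
  unfold quadratic
  rw [map_sum]
  refine Finset.sum_congr rfl fun i _ => ?_
  rw [map_sum]
  refine Finset.sum_congr rfl fun j _ => ?_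
  rw [map_smul, map_mul, grassmannRescale_flavour_psiBar, grassmannRescale_flavour_psi,
    smul_mul_assoc, mul_smul_comm, ← flavourPhaseWeight_inl fl f₀ θ i,
    ← flavourPhaseWeight_inr fl f₀ θ j, smul_smul (flavourPhaseWeight fl f₀ θ (toLex (Sum.inl i)))]
  by_cases hij : fl i = fl j
  · rw [flavourPhaseWeight_inl_mul_inr fl f₀ θ hij, one_smul]
  · rw [hA i j hij, zero_smul, zero_smul]

/-- Hence the Grassmann exponential of a flavour-diagonal bilinear (a fermionic Boltzmann
factor) is invariant. [cite: MontvayMunster1994, §5.1.1 (5.6)] -/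
theorem grassmannRescale_flavour_grassmannExp_quadratic (fl : ι → Fin Nf) (f₀ : Fin Nf) (θ : ℝ)
    (A : Matrix ι ι ℂ) (hA : ∀ i j, fl i ≠ fl j → A i j = 0) :
    grassmannRescale ℂ (flavourPhaseWeight fl f₀ θ) (grassmannExp (quadratic ℂ A)) =
      grassmannExp (quadratic ℂ A) :=
  map_grassmannExp_of_map_eq _ (grassmannRescale_flavour_quadratic fl f₀ θ A hA)

end Flavour

section FlavourBerezin

variable {ι : Type*} [LinearOrder ι] [Fintype ι] {Nf : ℕ}

/-- **The Berezin integral is flavour-rotation invariant** (the Jacobian `∏_w c_w` is `1`). [cite: MontvayMunster1994, §4.1 (4.21)] -/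
theorem berezin_grassmannRescale_flavour (fl : ι → Fin Nf) (f₀ : Fin Nf) (θ : ℝ)
    (x : GrassmannAlgebra ℂ (ι ⊕ₗ ι)) :
    GrassmannAlgebra.berezin ℂ (ι ⊕ₗ ι) (grassmannRescale ℂ (flavourPhaseWeight fl f₀ θ) x) =
      GrassmannAlgebra.berezin ℂ (ι ⊕ₗ ι) x := by
  rw [berezin_grassmannRescale, prod_flavourPhaseWeight, one_mul]

/-- Monomials are eigenvectors with eigenvalue `e^{i q θ}`, `q = #ψ_{f₀} − #ψ̄_{f₀}` the total
charge of the monomial. [cite: MontvayMunster1994, §5.1.1 (5.6)] -/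
theorem grassmannRescale_flavour_grassmannBasis (fl : ι → Fin Nf) (f₀ : Fin Nf) (θ : ℝ)
    (s : Finset (ι ⊕ₗ ι)) :
    grassmannRescale ℂ (flavourPhaseWeight fl f₀ θ) (GrassmannAlgebra.grassmannBasis ℂ (ι ⊕ₗ ι) s) =
      Complex.exp (((((∑ w ∈ s, flavourChargeOf fl f₀ w : ℤ) : ℝ) * θ : ℝ) : ℂ) * Complex.I) •
        GrassmannAlgebra.grassmannBasis ℂ (ι ⊕ₗ ι) s := by
  rw [grassmannRescale_grassmannBasis, prod_flavourPhaseWeight_eq_exp]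

end FlavourBerezin

/-- Charges add under products: if an algebra map multiplies `x` by `e^{iq₁θ}` and `y` by
`e^{iq₂θ}`, it multiplies `x * y` by `e^{i(q₁+q₂)θ}`. [folklore] -/
theorem map_mul_eq_exp_smul {B : Type*} [Ring B] [Algebra ℂ B] (φ : B →ₐ[ℂ] B) (θ : ℝ)
    {q₁ q₂ : ℤ} {x y : B} (hx : φ x = Complex.exp (((q₁ : ℝ) * θ : ℝ) * Complex.I) • x)
    (hy : φ y = Complex.exp (((q₂ : ℝ) * θ : ℝ) * Complex.I) • y) :
    φ (x * y) = Complex.exp ((((q₁ + q₂ : ℤ) : ℝ) * θ : ℝ) * Complex.I) • (x * y) := by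
  rw [map_mul, hx, hy, smul_mul_assoc, mul_smul_comm, smul_smul, ← Complex.exp_add]
  congr 2
  push_cast
  ring

/-! ### The flavour rotation of boxed and torus quark variables; flavour charge -/

section QCD

variable {Nf : ℕ} {R : ℕ}

/-- The flavour of a boxed quark-variable index. [cite: MontvayMunster1994, §5.1.1] -/
def boxFlavour : BoxFermiIdx Nf R → Fin Nf := fun i => (boxQuarkEquiv.symm i).1

/-- The flavour of a torus quark-variable index. [cite: MontvayMunster1994, §5.1.1] -/
def torusFlavour {S : ℕ} [NeZero S] : FermiIdx Nf S → Fin Nf := fun i => (quarkEquiv.symm i).1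

/-- **The flavour-`f₀` `U(1)` rephasing by the angle `θ` on generator coefficients of the boxed
quark variables**: the linear map multiplying the `ψ̄_{(f₀,·)}` coordinates (`Sum.inl`) by
`e^{-iθ}` and the `ψ_{(f₀,·)}` coordinates (`Sum.inr`) by `e^{+iθ}`, all other flavours fixed —
literally the map inlined in route `WilsonMobilityGap` (items `PhaseQuenchedFlavourDecay`,
`GluonicCompletion`). [cite: MontvayMunster1994, §5.1.1 (5.6)] -/
def fermiFlavourPhaseLin (f₀ : Fin Nf) (θ : ℝ) :
    ((BoxFermiIdx Nf R ⊕ₗ BoxFermiIdx Nf R) → ℂ) →ₗ[ℂ] ((BoxFermiIdx Nf R ⊕ₗ BoxFermiIdx Nf R) → ℂ) :=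
  LinearMap.pi fun w =>
    (Sum.elim (fun i => if (boxQuarkEquiv.symm i).1 = f₀ then Complex.exp (-((θ : ℂ) * Complex.I)) else 1)
        (fun i => if (boxQuarkEquiv.symm i).1 = f₀ then Complex.exp ((θ : ℂ) * Complex.I) else 1)
        (ofLex w)) •
      LinearMap.proj w

/-- The literal map is the diagonal rescaling by `flavourPhaseWeight boxFlavour f₀ θ`. [folklore] -/
theorem fermiFlavourPhaseLin_eq (f₀ : Fin Nf) (θ : ℝ) :
    fermiFlavourPhaseLin (R := R) f₀ θ = grassmannRescaleLin ℂ (flavourPhaseWeight boxFlavour f₀ θ) :=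
  rfl

/-- **The flavour-`f₀` `U(1)` rotation by `θ` of the boxed Grassmann algebra** `BoxFermiAlg N_f R`:
the algebra automorphism induced on generators by `fermiFlavourPhaseLin f₀ θ`
(`ψ_{f₀} ↦ e^{iθ}ψ_{f₀}`, `ψ̄_{f₀} ↦ e^{-iθ}ψ̄_{f₀}`; same pattern as `fermiGaugeAct`). [cite: MontvayMunster1994, §5.1.1 (5.6)] -/
def fermiFlavourPhase (f₀ : Fin Nf) (θ : ℝ) : BoxFermiAlg Nf R →ₐ[ℂ] BoxFermiAlg Nf R :=
  ExteriorAlgebra.map (fermiFlavourPhaseLin f₀ θ)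

/-- `fermiFlavourPhase` is the generic rescaling by the flavour weights (definitionally). [folklore] -/
theorem fermiFlavourPhase_eq (f₀ : Fin Nf) (θ : ℝ) :
    fermiFlavourPhase (R := R) f₀ θ = grassmannRescale ℂ (flavourPhaseWeight boxFlavour f₀ θ) :=
  rfl

/-- **The same rotation on the torus Grassmann algebra** `FermiAlg N_f S` (all quark variables of
the torus of side `S`). [cite: MontvayMunster1994, §5.1.1 (5.6)] -/
def torusFlavourPhase {S : ℕ} [NeZero S] (f₀ : Fin Nf) (θ : ℝ) : FermiAlg Nf S →ₐ[ℂ] FermiAlg Nf S :=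
  grassmannRescale ℂ (flavourPhaseWeight torusFlavour f₀ θ)

namespace QCDLatticeObservable

/-- **Flavour charge `q` of a gauge-invariant local lattice-QCD observable under `U(1)_{f₀}`**:
`A(U)` is multiplied by `e^{iqθ}` under the rotation of flavour `f₀` by `θ`, for every angle and
every gauge field. `A` is *flavour-charged* when this holds for some `f₀` and some `q ≠ 0`
(e.g. a flavoured meson `ψ̄_f Γ ψ_g`, `f ≠ g`, or a baryon). [cite: MontvayMunster1994, §5.1.1 (5.6)] [cite: OsterwalderSeiler1978, §2] -/
def IsFlavourCharged (A : QCDLatticeObservable Nf R) (f₀ : Fin Nf) (q : ℤ) : Prop :=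
  ∀ (θ : ℝ) (U : LGConfig 4 (Matrix.specialUnitaryGroup (Fin 3) ℂ)),
    fermiFlavourPhase f₀ θ (A.F U) = Complex.exp (((q : ℝ) * θ : ℝ) * Complex.I) • A.F U

/-- `IsFlavourCharged` is, definitionally, the hypothesis inlined in route `WilsonMobilityGap`
(items `PhaseQuenchedFlavourDecay`, `GluonicCompletion`). [folklore] -/
theorem isFlavourCharged_iff (A : QCDLatticeObservable Nf R) (f₀ : Fin Nf) (q : ℤ) :
    A.IsFlavourCharged f₀ q ↔ ∀ (θ : ℝ) (U : LGConfig 4 (Matrix.specialUnitaryGroup (Fin 3) ℂ)),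
      ExteriorAlgebra.map (LinearMap.pi fun w => (Sum.elim
          (fun i => if (boxQuarkEquiv.symm i).1 = f₀ then Complex.exp (-((θ : ℂ) * Complex.I)) else 1)
          (fun i => if (boxQuarkEquiv.symm i).1 = f₀ then Complex.exp ((θ : ℂ) * Complex.I) else 1)
          (ofLex w)) • LinearMap.proj w) (A.F U) =
        Complex.exp (((q : ℝ) * θ : ℝ) * Complex.I) • A.F U :=
  Iff.rfl

/-- The unit observable is neutral. [folklore] -/
theorem isFlavourCharged_one (f₀ : Fin Nf) : (one Nf R).IsFlavourCharged f₀ 0 := by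
  intro θ U
  simp [one]

end QCDLatticeObservable

/-! #### Group action and action on generators -/

/-- `ψᵢ ↦ e^{iθ}ψᵢ` for boxed quark variables of flavour `f₀`, fixed otherwise. [cite: MontvayMunster1994, §5.1.1 (5.6)] -/
theorem fermiFlavourPhase_psi (f₀ : Fin Nf) (θ : ℝ) (i : BoxFermiIdx Nf R) :
    fermiFlavourPhase f₀ θ (psi ℂ i) =
      (if (boxQuarkEquiv.symm i).1 = f₀ then Complex.exp ((θ : ℂ) * Complex.I) else 1) • psi ℂ i :=
  grassmannRescale_flavour_psi boxFlavour f₀ θ i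

/-- `ψ̄ᵢ ↦ e^{-iθ}ψ̄ᵢ` for boxed quark variables of flavour `f₀`, fixed otherwise. [cite: MontvayMunster1994, §5.1.1 (5.6)] -/
theorem fermiFlavourPhase_psiBar (f₀ : Fin Nf) (θ : ℝ) (i : BoxFermiIdx Nf R) :
    fermiFlavourPhase f₀ θ (psiBar ℂ i) =
      (if (boxQuarkEquiv.symm i).1 = f₀ then Complex.exp (-((θ : ℂ) * Complex.I)) else 1) •
        psiBar ℂ i :=
  grassmannRescale_flavour_psiBar boxFlavour f₀ θ i

/-- Angle `0` acts as the identity. [folklore] -/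
theorem fermiFlavourPhase_zero (f₀ : Fin Nf) : fermiFlavourPhase (R := R) f₀ 0 = AlgHom.id ℂ _ := by
  rw [fermiFlavourPhase_eq, flavourPhaseWeight_zero, grassmannRescale_one]

/-- **Group action in the angle**: rotation by `θ₁ + θ₂` is rotation by `θ₂` followed by `θ₁`. [cite: MontvayMunster1994, §5.1.1 (5.6)] -/
theorem fermiFlavourPhase_add (f₀ : Fin Nf) (θ₁ θ₂ : ℝ) :
    fermiFlavourPhase (R := R) f₀ (θ₁ + θ₂) =
      (fermiFlavourPhase f₀ θ₁).comp (fermiFlavourPhase f₀ θ₂) := by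
  rw [fermiFlavourPhase_eq, fermiFlavourPhase_eq, fermiFlavourPhase_eq, flavourPhaseWeight_add,
    grassmannRescale_mul]

/-- Rotation by `-θ` inverts rotation by `θ`. [folklore] -/
theorem fermiFlavourPhase_comp_neg (f₀ : Fin Nf) (θ : ℝ) :
    (fermiFlavourPhase (R := R) f₀ θ).comp (fermiFlavourPhase f₀ (-θ)) = AlgHom.id ℂ _ := by
  rw [← fermiFlavourPhase_add, add_neg_cancel, fermiFlavourPhase_zero]

/-- **Monomials are eigenvectors**: the basis monomial `θ_s` of the boxed Grassmann algebra has
charge `∑_{w ∈ s} flavourChargeOf w = #ψ_{f₀} − #ψ̄_{f₀}`. [cite: MontvayMunster1994, §5.1.1 (5.6)] -/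
theorem fermiFlavourPhase_grassmannBasis (f₀ : Fin Nf) (θ : ℝ)
    (s : Finset (BoxFermiIdx Nf R ⊕ₗ BoxFermiIdx Nf R)) :
    fermiFlavourPhase f₀ θ (GrassmannAlgebra.grassmannBasis ℂ _ s) =
      Complex.exp (((((∑ w ∈ s, flavourChargeOf boxFlavour f₀ w : ℤ) : ℝ) * θ : ℝ) : ℂ) * Complex.I) •
        GrassmannAlgebra.grassmannBasis ℂ _ s :=
  grassmannRescale_flavour_grassmannBasis boxFlavour f₀ θ s

/-- Torus version: `ψ_v ↦ e^{iθ}ψ_v` for quark variables `v` of flavour `f₀`. [cite: MontvayMunster1994, §5.1.1 (5.6)] -/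
theorem torusFlavourPhase_q {S : ℕ} [NeZero S] (f₀ : Fin Nf) (θ : ℝ) (v : QuarkVar Nf S) :
    torusFlavourPhase f₀ θ (q v) = (if v.1 = f₀ then Complex.exp ((θ : ℂ) * Complex.I) else 1) • q v := by
  rw [q, torusFlavourPhase, grassmannRescale_flavour_psi]
  simp [torusFlavour]

/-- Torus version: `ψ̄_v ↦ e^{-iθ}ψ̄_v` for quark variables `v` of flavour `f₀`. [cite: MontvayMunster1994, §5.1.1 (5.6)] -/
theorem torusFlavourPhase_qbar {S : ℕ} [NeZero S] (f₀ : Fin Nf) (θ : ℝ) (v : QuarkVar Nf S) :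
    torusFlavourPhase f₀ θ (qbar v) =
      (if v.1 = f₀ then Complex.exp (-((θ : ℂ) * Complex.I)) else 1) • qbar v := by
  rw [qbar, torusFlavourPhase, grassmannRescale_flavour_psiBar]
  simp [torusFlavour]

/-- Torus version of the group law. [folklore] -/
theorem torusFlavourPhase_add {S : ℕ} [NeZero S] (f₀ : Fin Nf) (θ₁ θ₂ : ℝ) :
    torusFlavourPhase (Nf := Nf) (S := S) f₀ (θ₁ + θ₂) =
      (torusFlavourPhase f₀ θ₁).comp (torusFlavourPhase f₀ θ₂) := by
  rw [torusFlavourPhase, torusFlavourPhase, torusFlavourPhase, flavourPhaseWeight_add,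
    grassmannRescale_mul]

/-! #### Torus placement -/

/-- The torus placement of boxed quark variables preserves the flavour weights. [folklore] -/
theorem flavourPhaseWeight_toTorusIdx (S : ℕ) [NeZero S]
    (v : _root_.Literature.Probability.LatticeModels.Site 4) (f₀ : Fin Nf) (θ : ℝ)
    (w : BoxFermiIdx Nf R ⊕ₗ BoxFermiIdx Nf R) :
    flavourPhaseWeight torusFlavour f₀ θ (QCDLatticeObservable.toTorusIdx S v w) =
      flavourPhaseWeight boxFlavour f₀ θ w := by
  obtain ⟨w, rfl⟩ := toLex.surjective w
  rcases w with i | i <;> simp [QCDLatticeObservable.toTorusIdx, torusFlavour, boxFlavour]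

/-- **`onTorus` intertwines the box and torus rotations**: rotating after placing the boxed
variables on the torus equals placing the rotated element. [folklore] -/
theorem torusFlavourPhase_map_toTorusIdx (S : ℕ) [NeZero S]
    (v : _root_.Literature.Probability.LatticeModels.Site 4) (f₀ : Fin Nf) (θ : ℝ)
    (y : BoxFermiAlg Nf R) :
    torusFlavourPhase f₀ θ (ExteriorAlgebra.map (Fintype.linearCombination ℂ fun w =>
        Pi.single (QCDLatticeObservable.toTorusIdx (Nf := Nf) (R := R) S v w) (1 : ℂ)) y) =
      ExteriorAlgebra.map (Fintype.linearCombination ℂ fun w =>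
        Pi.single (QCDLatticeObservable.toTorusIdx (Nf := Nf) (R := R) S v w) (1 : ℂ))
        (fermiFlavourPhase f₀ θ y) := by
  have h := map_relabel_comp_grassmannRescale ℂ (QCDLatticeObservable.toTorusIdx (Nf := Nf) (R := R) S v)
    (flavourPhaseWeight boxFlavour f₀ θ) (flavourPhaseWeight torusFlavour f₀ θ)
    (flavourPhaseWeight_toTorusIdx S v f₀ θ)
  exact (DFunLike.congr_fun h y).symm

/-- A flavour-charged observable stays flavour-charged, with the same charge, after placement
on any torus at any site. [folklore] -/
theorem QCDLatticeObservable.IsFlavourCharged.onTorus {A : QCDLatticeObservable Nf R}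
    {f₀ : Fin Nf} {q : ℤ} (hA : A.IsFlavourCharged f₀ q) (S : ℕ) [NeZero S]
    (v : _root_.Literature.Probability.LatticeModels.Site 4)
    (U : GaugeConfig 4 S (Matrix.specialUnitaryGroup (Fin 3) ℂ)) (θ : ℝ) :
    torusFlavourPhase f₀ θ (A.onTorus S v U) =
      Complex.exp (((q : ℝ) * θ : ℝ) * Complex.I) • A.onTorus S v U := by
  unfold QCDLatticeObservable.onTorus
  rw [torusFlavourPhase_map_toTorusIdx, hA θ, map_smul]

/-! #### The key lemma: charged elements integrate to zero against the Boltzmann factor -/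

/-- The `N_f`-flavour Wilson–Dirac matrix is flavour-diagonal. [cite: MontvayMunster1994, §5.1.1 (5.6)] -/
theorem diracMatrix_eq_zero_of_flavour_ne {S : ℕ} [NeZero S]
    (U : GaugeConfig 4 S (Matrix.specialUnitaryGroup (Fin 3) ℂ))
    (mq : Fin Nf → ℝ) {i j : FermiIdx Nf S} (h : torusFlavour i ≠ torusFlavour j) :
    diracMatrix U mq i j = 0 := by
  simp only [torusFlavour, ne_eq] at h
  simp [diracMatrix, h]

/-- **Flavour symmetry of the Wilson action**: the fermionic Boltzmann factor
`exp(−ψ̄ D(U) ψ)` is invariant under every `U(1)_{f₀}` rotation. [cite: MontvayMunster1994, §5.1.1 (5.6)] -/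
theorem torusFlavourPhase_fermiBoltzmann {S : ℕ} [NeZero S] (f₀ : Fin Nf) (θ : ℝ)
    (U : GaugeConfig 4 S (Matrix.specialUnitaryGroup (Fin 3) ℂ)) (mq : Fin Nf → ℝ) :
    torusFlavourPhase f₀ θ (fermiBoltzmann U mq) = fermiBoltzmann U mq :=
  grassmannRescale_flavour_grassmannExp_quadratic torusFlavour f₀ θ (-diracMatrix U mq)
    fun i j h => by rw [Matrix.neg_apply, diracMatrix_eq_zero_of_flavour_ne U mq h, neg_zero]

/-- **The Berezin integral over all quark variables is flavour-rotation invariant.** [cite: MontvayMunster1994, §4.1 (4.21)] -/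
theorem fermiIntegral_torusFlavourPhase {S : ℕ} [NeZero S] (f₀ : Fin Nf) (θ : ℝ) (x : FermiAlg Nf S) :
    fermiIntegral (torusFlavourPhase f₀ θ x) = fermiIntegral x :=
  berezin_grassmannRescale_flavour torusFlavour f₀ θ x

/-- **KEY LEMMA: a flavour-charged Grassmann element integrates to zero against the fermionic
Boltzmann factor** — `∫dψ̄dψ Y e^{−ψ̄Dψ} = e^{inθ} ∫dψ̄dψ Y e^{−ψ̄Dψ}` for all `θ` by invariance of
the measure and of the action, and `e^{inθ} = -1` for `θ = π/n`. [cite: MontvayMunster1994, §5.1.1 (5.6)] -/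
theorem fermiIntegral_mul_fermiBoltzmann_eq_zero_of_charged {S : ℕ} [NeZero S] (f₀ : Fin Nf)
    {n : ℤ} (hn : n ≠ 0) {Y : FermiAlg Nf S}
    (hY : ∀ θ : ℝ, torusFlavourPhase f₀ θ Y = Complex.exp (((n : ℝ) * θ : ℝ) * Complex.I) • Y)
    (U : GaugeConfig 4 S (Matrix.specialUnitaryGroup (Fin 3) ℂ)) (mq : Fin Nf → ℝ) :
    fermiIntegral (Y * fermiBoltzmann U mq) = 0 := by
  have hθ : ((n : ℝ) * (Real.pi / n) : ℝ) = Real.pi := by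
    have : (n : ℝ) ≠ 0 := Int.cast_ne_zero.mpr hn
    field_simp
  have h1 : fermiIntegral (Y * fermiBoltzmann U mq) = -fermiIntegral (Y * fermiBoltzmann U mq) := by
    conv_lhs => rw [← fermiIntegral_torusFlavourPhase f₀ (Real.pi / n) (Y * fermiBoltzmann U mq)]
    rw [map_mul, hY, torusFlavourPhase_fermiBoltzmann, smul_mul_assoc, map_smul, smul_eq_mul, hθ,
      Complex.exp_pi_mul_I, neg_one_mul]
  linear_combination (1 / 2 : ℂ) * h1

/-- Hence `⟨A⟩_F(U) = 0` numerator-wise for a flavour-charged observable: its Berezin integral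
against the Boltzmann factor vanishes on every torus, at every site, in every gauge field. [cite: MontvayMunster1994, §5.1.1 (5.6)] [cite: OsterwalderSeiler1978, §2] -/
theorem QCDLatticeObservable.IsFlavourCharged.fermiIntegral_onTorus_mul_fermiBoltzmann
    {A : QCDLatticeObservable Nf R} {f₀ : Fin Nf} {n : ℤ} (hA : A.IsFlavourCharged f₀ n)
    (hn : n ≠ 0) (S : ℕ) [NeZero S] (v : _root_.Literature.Probability.LatticeModels.Site 4)
    (U : GaugeConfig 4 S (Matrix.specialUnitaryGroup (Fin 3) ℂ)) (mq : Fin Nf → ℝ) :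
    fermiIntegral (A.onTorus S v U * fermiBoltzmann U mq) = 0 :=
  fermiIntegral_mul_fermiBoltzmann_eq_zero_of_charged f₀ hn (fun θ => hA.onTorus S v U θ) U mq

/-- The lattice QCD expectation `qcdTorusExpect` of a flavour-charged observable vanishes. [folklore] -/
theorem QCDLatticeObservable.IsFlavourCharged.qcdTorusExpect_onTorus
    {A : QCDLatticeObservable Nf R} {f₀ : Fin Nf} {n : ℤ} (hA : A.IsFlavourCharged f₀ n)
    (hn : n ≠ 0) (β : ℝ) (S : ℕ) [NeZero S] (mq : Fin Nf → ℝ)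
    (v : _root_.Literature.Probability.LatticeModels.Site 4) :
    qcdTorusExpect β S mq (A.onTorus S v) = 0 := by
  simp [qcdTorusExpect, hA.fermiIntegral_onTorus_mul_fermiBoltzmann hn]

/-- **For a flavour-charged observable the connected and the full Euclidean-time correlators
coincide.** [folklore] -/
theorem QCDLatticeObservable.IsFlavourCharged.qcdLatticeConnectedCorr_eq
    {A : QCDLatticeObservable Nf R} {f₀ : Fin Nf} {n : ℤ} (hA : A.IsFlavourCharged f₀ n)
    (hn : n ≠ 0) {R' : ℕ} (B : QCDLatticeObservable Nf R') (β : ℝ) (S : ℕ) [NeZero S]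
    (mq : Fin Nf → ℝ) (k : ℕ) :
    qcdLatticeConnectedCorr β S mq A B k =
      qcdTorusExpect β S mq (fun U => A.onTorus S 0 U * B.onTorus S (Pi.single 0 (k : ℤ)) U) := by
  rw [qcdLatticeConnectedCorr, hA.qcdTorusExpect_onTorus hn, zero_mul, sub_zero]

end QCD

end Literature.MathematicalPhysics.QuantumFieldTheory

end
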